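import Mathlib
import Summits.NavierStokesRegularity.NavierStokesRegularity.Theorems.EulerZoomLiouvillePowerGaugeEulerLiouvilleSelfSimilarBernoulliBounded
import HarnessLib.Audit

/-!
# Crux `EulerZoomLiouville.PowerGaugeEulerLiouville` (stmt-NavierStokesRegularity-19832), THE ONE STATEMENT `stub_selfSimilarC2Needle`:
# THE VORTICITY OF THE NEEDLE SITS AT UNBOUNDED BERNOULLI LEVELS OR IN A PRESSURISED FAR FIELD — the vortical-set form of `…SelfSimilarBernoulliBounded`

Route №10 `EulerZoomLiouville` (NavierStokesRegularity), crux E = stmt-NavierStokesRegularity-19832; LEAD ns-typeII-p2 g11, own stub.  Sharpening of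
`Loc.curl_eq_zero_of_bernoulli_le_of_pressure_le` (p629868): a backward similarity orbit through a vortical point is VORTICAL THROUGHOUT (linear Cauchy equation for
`e^{−(1+γ)t} curl U(Y t)`, `NodalFiniteness.hasDerivAt_weightedCurl_comp` + uniqueness), so both hypotheses are needed ONLY ON THE VORTICAL SET `{curl U ≠ 0}`:

> (`Loc.curl_eq_zero_of_vortical_bernoulli_le`) a `C²` profile of CIV (3.3) with `0 < γ < ½` such that `ℋ(y) ≤ M̄` at every VORTICAL point `y` and `P(y) ≤ ε‖y‖²` at every
> vortical point with `‖y‖ ≥ R₀` (`ε < ½γ(1−γ)`) is irrotational; member form `Loc.selfSimilar_ae_eq_zero_of_vorticalBoundedBernoulliC2_profile` (all classical pressures).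

READING for THE ONE STATEMENT: its needle's VORTICITY reaches arbitrarily high Bernoulli levels (`sup_{curl V ≠ 0} ℋ = +∞`) or sits, beyond every radius, at pressurised points
(`P′ > ε‖y‖²`, every `ε < ½γ(1−γ)`); irrotational cores and pressure pockets without vorticity are irrelevant.
WHAT THIS IS NOT: not NS, not E — a sub-stratum of THE ONE STATEMENT; 19832 is OPEN. [folklore; ConstantinIgnatovaVicol2026Putative §3.4.1 (3.23)–(3.24), §3.4.3 (3.31)]
-/

noncomputable section

set_option linter.dupNamespace false

open MeasureTheory Set Filter Topology Metric Function InnerProductSpace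
open scoped RealInnerProductSpace NNReal ENNReal ContDiff

namespace Summit.NavierStokesRegularity.NavierStokesRegularity.Theorems.PowerGaugeEulerLiouville.Loc

open Literature.Analysis Literature.Analysis.FluidPDE
open Summit.NavierStokesRegularity.NavierStokesRegularity.Theorems.PowerGaugeEulerLiouville.Kelvin
open Summit.NavierStokesRegularity.NavierStokesRegularity.Theorems.PowerGaugeEulerLiouville.NodalFiniteness

variable {γ : ℝ} {U : EuclideanSpace ℝ (Fin 3) → EuclideanSpace ℝ (Fin 3)} {P : EuclideanSpace ℝ (Fin 3) → ℝ}

set_option maxHeartbeats 400000 in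
/-- **Bounded Bernoulli levels and sub-critical pressure ON THE VORTICAL SET force irrotationality.**  `(U, P)` a `C²` profile of CIV (3.3) with `0 < γ < ½`;
`ℋ(y) ≤ M̄` whenever `curl U y ≠ 0`; `P(y) ≤ ε‖y‖²` whenever `curl U y ≠ 0` and `‖y‖ ≥ R₀`, with `ε < ½γ(1−γ)`.  Then `curl U ≡ 0`.  (As in
`curl_eq_zero_of_bernoulli_le_of_pressure_le`, using that backward orbits of vortical points stay vortical.) [folklore] -/
theorem curl_eq_zero_of_vortical_bernoulli_le (hprof : IsSelfSimilarEulerProfile γ 0 U P) (hγ : 0 < γ) (hγ2 : γ < 1 / 2)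
    {Mb : ℝ} (hMb : ∀ y, curl U y ≠ 0 → selfSimilarBernoulli γ 0 U P y ≤ Mb)
    {ε R₀ : ℝ} (hε : ε < γ * (1 - γ) / 2)
    (hP : ∀ y : EuclideanSpace ℝ (Fin 3), R₀ ≤ ‖y‖ → curl U y ≠ 0 → P y ≤ ε * ‖y‖ ^ 2)
    (x₀ : EuclideanSpace ℝ (Fin 3)) : curl U x₀ = 0 := by
  -- adapted from `curl_eq_zero_of_bernoulli_le_of_pressure_le` (…SelfSimilarBernoulliBounded, p629868)
  have hU2 : ContDiff ℝ 2 U := hprof.contDiff_velocity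
  have hU1 : ContDiff ℝ 1 U := hU2.of_le (by norm_num)
  set Hb : EuclideanSpace ℝ (Fin 3) → ℝ := selfSimilarBernoulli γ 0 U P with hHb
  have hHc : Continuous Hb := hprof.contDiff_selfSimilarBernoulli.continuous
  -- Bernoulli floor `h₀` on the closed unit ball about `x₀`
  obtain ⟨z₀, -, hz₀⟩ := (isCompact_closedBall x₀ (1 : ℝ)).exists_isMinOn ⟨x₀, mem_closedBall_self zero_le_one⟩ hHc.continuousOn
  set h₀ : ℝ := Hb z₀ with hh₀
  have hfloor : ∀ x : EuclideanSpace ℝ (Fin 3), dist x x₀ < 1 → h₀ ≤ Hb x :=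
    fun x hx => hz₀ (mem_closedBall.2 hx.le)
  by_cases hx₀Ω : curl U x₀ = 0
  · exact hx₀Ω
  have hMb0 : h₀ ≤ Mb := (hfloor x₀ (by simp)).trans (hMb x₀ hx₀Ω)
  -- constants: speed floor `a`, kinetic budget `E`, inner radius `R₁`, pinned floor `m = a R₁²`, outer radius `K`
  set a : ℝ := γ * (1 - γ) / 2 - ε with ha
  have ha0 : 0 < a := by rw [ha]; linarith
  have h12 : 0 < 1 - 2 * γ := by linarith
  set E : ℝ := (Mb - h₀) / (1 - 2 * γ) with hE
  have hE0 : 0 ≤ E := div_nonneg (by linarith) h12.le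
  set R₁ : ℝ := max (max R₀ (‖x₀‖ + 1)) (max 1 (Real.sqrt (2 * |h₀| / a) + 1)) with hR₁
  have hR₁R₀ : R₀ ≤ R₁ := (le_max_left _ _).trans (le_max_left _ _)
  have hR₁x : ‖x₀‖ + 1 ≤ R₁ := (le_max_right _ _).trans (le_max_left _ _)
  have hR₁1 : 1 ≤ R₁ := (le_max_left _ _).trans (le_max_right _ _)
  have hR₁h : Real.sqrt (2 * |h₀| / a) + 1 ≤ R₁ := (le_max_right _ _).trans (le_max_right _ _)
  have hR₁pos : 0 < R₁ := by linarith
  -- for `‖y‖ ≥ R₁`: `a‖y‖² + h₀ ≥ (a/2)‖y‖²`, i.e. `(a/2)‖y‖² ≥ -h₀`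
  have hhalf : ∀ r : ℝ, R₁ ≤ r → -h₀ ≤ a / 2 * r ^ 2 := by
    intro r hr
    have h1 : Real.sqrt (2 * |h₀| / a) ≤ r := by linarith
    have h2 : 2 * |h₀| / a ≤ r ^ 2 := by
      have h3 : 0 ≤ 2 * |h₀| / a := div_nonneg (by positivity) ha0.le
      calc 2 * |h₀| / a = Real.sqrt (2 * |h₀| / a) ^ 2 := (Real.sq_sqrt h3).symm
        _ ≤ r ^ 2 := pow_le_pow_left₀ (Real.sqrt_nonneg _) h1 2
    have h4 : 2 * |h₀| ≤ a * r ^ 2 := by have := (div_le_iff₀ ha0).1 h2; linarith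
    have h5 : -h₀ ≤ |h₀| := neg_le_abs h₀
    nlinarith
  set m : ℝ := a * R₁ ^ 2 with hm
  have hm0 : 0 < m := by positivity
  set K : ℝ := R₁ + E / Real.sqrt m + 1 with hK
  have hsqm : 0 < Real.sqrt m := Real.sqrt_pos.2 hm0
  have hKR₁ : R₁ + 1 ≤ K := by
    have : 0 ≤ E / Real.sqrt m := div_nonneg hE0 hsqm.le
    rw [hK]; linarith
  have hKpos : 0 < K := by linarith
  -- speed floor on the high set far out: `ℋ y ≥ h₀`, `‖y‖ ≥ R₁` ⇒ `‖W y‖² ≥ a‖y‖² ≥ m`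
  have hspeed : ∀ y : EuclideanSpace ℝ (Fin 3), R₁ ≤ ‖y‖ → h₀ ≤ Hb y → curl U y ≠ 0 →
      m ≤ ‖selfSimilarTransport γ 0 U y‖ ^ 2 := by
    intro y hy hHy hΩy
    have hPy : P y ≤ ε * ‖y‖ ^ 2 := hP y (hR₁R₀.trans hy) hΩy
    have hHb_eq : Hb y = (1 / 2 : ℝ) * ‖γ • (y - 0) + U y‖ ^ 2 + P y + γ * (γ - 1) / 2 * ‖y - 0‖ ^ 2 :=
      selfSimilarBernoulli_apply γ 0 U P y
    have hW : selfSimilarTransport γ 0 U y = γ • (y - 0) + U y := selfSimilarTransport_apply γ 0 U y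
    rw [hW]
    rw [sub_zero] at hHb_eq
    have hy2 : R₁ ^ 2 ≤ ‖y‖ ^ 2 := pow_le_pow_left₀ hR₁pos.le hy 2
    have hh := hhalf ‖y‖ hy
    rw [sub_zero]
    -- ½‖W‖² = ℋ − P − ½γ(γ−1)‖y‖² ≥ h₀ − ε‖y‖² + ½γ(1−γ)‖y‖² = a‖y‖² + h₀ + … ≥ (a/2)‖y‖² + a/2 ‖y‖²… ≥ a R₁²
    nlinarith [hHb_eq, hHy, hPy, hy2, hh, ha0]
  -- the cut-off field on `ball 0 (K+1)` and its global flow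
  obtain ⟨V, hV, ⟨M, hVM⟩, -, ⟨Kd, hKd⟩, hagree⟩ := exists_cutoff_local_smul hU2 (R := K + 1) (by linarith)
  have hV1 : ContDiff ℝ 1 V := hV.of_le (by norm_num)
  have hnear : ∀ z : EuclideanSpace ℝ (Fin 3), ‖z‖ ≤ K → V =ᶠ[𝓝 z] U := by
    intro z hz
    have hmem : ball (0 : EuclideanSpace ℝ (Fin 3)) (K + 1) ∈ 𝓝 z := isOpen_ball.mem_nhds (by rw [mem_ball, dist_zero_right]; linarith)
    exact Filter.eventually_of_mem hmem fun y hy => hagree y hy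
  have hDeq : ∀ z : EuclideanSpace ℝ (Fin 3), ‖z‖ ≤ K → fderiv ℝ V z = fderiv ℝ U z :=
    fun z hz => (hnear z hz).fderiv_eq
  have hWeq : ∀ z : EuclideanSpace ℝ (Fin 3), ‖z‖ ≤ K →
      selfSimilarTransport γ 0 V z = selfSimilarTransport γ 0 U z := by
    intro z hz
    simp only [selfSimilarTransport_apply, hagree z (by rw [mem_ball, dist_zero_right]; linarith)]
  set Φ := ODE.evolutionMap (fun _ : ℝ => selfSimilarTransport γ 0 V) 0 with hΦ
  -- every vortical point near `x₀` has a backward `U`-half-orbit confined in `‖y‖ ≤ K`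
  have hsubset : {x : EuclideanSpace ℝ (Fin 3) | dist x x₀ < 1 ∧ curl U x ≠ 0} ⊆
      {x : EuclideanSpace ℝ (Fin 3) | curl U x ≠ 0 ∧
        ∃ Y : ℝ → EuclideanSpace ℝ (Fin 3), Y 0 = x ∧
          (∀ t, 0 ≤ t → HasDerivAt Y ((-1 : ℝ) • selfSimilarTransport γ 0 U (Y t)) t) ∧
          ∀ t, 0 ≤ t → ‖Y t‖ ≤ K} := by
    rintro x ⟨hx, hcx⟩
    have hxR : ‖x‖ < R₁ := by
      have := norm_le_norm_add_norm_sub' x x₀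
      rw [← dist_eq_norm] at this
      linarith
    have hxK : ‖x‖ < K := by linarith
    set Yp : ℝ → EuclideanSpace ℝ (Fin 3) := fun t => Φ (-t) x with hYp
    have hYpV : ∀ t, HasDerivAt Yp ((-1 : ℝ) • selfSimilarTransport γ 0 V (Yp t)) t :=
      fun t => C2.Kelvin.hasDerivAt_flow_neg (γ := γ) hV1 hKd x t
    have hYpc : Continuous Yp := continuous_iff_continuousAt.2 fun t => (hYpV t).continuousAt
    have hYp0 : Yp 0 = x := by simp [hYp, hΦ, ODE.evolutionMap_self]
    have hYpU : ∀ t, ‖Yp t‖ ≤ K → HasDerivAt Yp ((-1 : ℝ) • selfSimilarTransport γ 0 U (Yp t)) t := by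
      intro t ht
      have h := hYpV t
      rwa [hWeq (Yp t) ht] at h
    by_cases hconf : ∀ t, 0 ≤ t → ‖Yp t‖ ≤ K
    · exact ⟨hcx, Yp, hYp0, fun t ht => hYpU t (hconf t ht), hconf⟩
    -- otherwise: FIRST EXIT through the sphere `‖y‖ = K` at time `t₁`
    exfalso
    push Not at hconf
    obtain ⟨t₂, ht₂0, ht₂R⟩ := hconf
    set T : Set ℝ := {t | 0 ≤ t ∧ K ≤ ‖Yp t‖} with hT
    have hTne : T.Nonempty := ⟨t₂, ht₂0, ht₂R.le⟩
    have hTcl : IsClosed T := by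
      rw [hT, setOf_and]
      exact (isClosed_le continuous_const continuous_id).inter (isClosed_le continuous_const hYpc.norm)
    have hTbdd : BddBelow T := ⟨0, fun t ht => ht.1⟩
    set t₁ : ℝ := sInf T with ht₁
    have ht₁T : t₁ ∈ T := hTcl.csInf_mem hTne hTbdd
    have ht₁0 : 0 ≤ t₁ := ht₁T.1
    have hbefore : ∀ t, 0 ≤ t → t < t₁ → ‖Yp t‖ < K := by
      intro t ht0 htlt
      by_contra hge
      push Not at hge
      have : t₁ ≤ t := csInf_le hTbdd ⟨ht0, hge⟩
      linarith
    have ht₁pos : 0 < t₁ := by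
      rcases ht₁0.lt_or_eq with h | h
      · exact h
      · exfalso; have := ht₁T.2; rw [← h, hYp0] at this; linarith
    have hnorm₁ : ‖Yp t₁‖ = K := by
      refine le_antisymm ?_ ht₁T.2
      by_contra hgt
      push Not at hgt
      have hev : ∀ᶠ t in 𝓝 t₁, K < ‖Yp t‖ :=
        (hYpc.norm.continuousAt (x := t₁)).eventually (lt_mem_nhds hgt)
      obtain ⟨δ, hδ, hball⟩ := Metric.eventually_nhds_iff.1 hev
      set t : ℝ := max (t₁ - δ / 2) 0 with htdef
      have ht0 : 0 ≤ t := le_max_right _ _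
      have htlt : t < t₁ := by
        rw [htdef]; exact max_lt (by linarith) ht₁pos
      have hdist : dist t t₁ < δ := by
        rw [dist_comm, Real.dist_eq, abs_of_nonneg (by linarith)]
        have : t₁ - δ / 2 ≤ t := le_max_left _ _
        linarith
      have h1 := hball hdist
      have h2 := hbefore t ht0 htlt
      linarith
    have hin : ∀ t ∈ Icc 0 t₁, ‖Yp t‖ ≤ K := by
      intro t ht
      rcases ht.2.lt_or_eq with h | h
      · exact (hbefore t ht.1 h).le
      · rw [h, hnorm₁]
    have hYpU' : ∀ t ∈ Icc 0 t₁, HasDerivAt Yp ((-1 : ℝ) • selfSimilarTransport γ 0 U (Yp t)) t :=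
      fun t ht => hYpU t (hin t ht)
    -- the orbit stays VORTICAL on `[0, t₁]`: linear Cauchy equation for `e^{−(1+γ)t} curl U (Yp t)` + uniqueness
    have hvort : ∀ t' ∈ Icc 0 t₁, curl U (Yp t') ≠ 0 := by
      intro t' ht' hzero
      set A : ℝ → EuclideanSpace ℝ (Fin 3) →L[ℝ] EuclideanSpace ℝ (Fin 3) :=
        fun t => (-1 : ℝ) • fderiv ℝ (selfSimilarTransport γ 0 U) (Yp t) with hA
      set uu : ℝ → EuclideanSpace ℝ (Fin 3) := fun r => Real.exp ((-1 : ℝ) * (1 + γ) * r) • curl U (Yp r) with huu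
      have huu' : ∀ t ∈ Icc 0 t', HasDerivAt uu (A t (uu t)) t := fun t ht =>
        hasDerivAt_weightedCurl_comp hprof (hYpU' t ⟨ht.1, ht.2.trans ht'.2⟩)
      have hKV : ∀ t ∈ Icc 0 t', LipschitzOnWith (Real.toNNReal (|γ| + Kd))
          (fun w : EuclideanSpace ℝ (Fin 3) => A t w) univ := by
        intro t ht
        refine ((A t).lipschitz.weaken ?_).lipschitzOnWith
        have hK0 : 0 ≤ Kd := (norm_nonneg _).trans (hKd 0)
        rw [← NNReal.coe_le_coe, coe_nnnorm, Real.coe_toNNReal _ (add_nonneg (abs_nonneg γ) hK0)]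
        calc ‖A t‖ = ‖fderiv ℝ (selfSimilarTransport γ 0 U) (Yp t)‖ := by
              show ‖(-1 : ℝ) • fderiv ℝ (selfSimilarTransport γ 0 U) (Yp t)‖ = _
              rw [norm_smul, norm_neg, norm_one, one_mul]
          _ ≤ |γ| + Kd := by
              rw [fderiv_transport_eq hprof (Yp t)]
              refine (norm_add_le _ _).trans (add_le_add ?_ ?_)
              · rw [norm_smul, Real.norm_eq_abs]
                exact mul_le_of_le_one_right (abs_nonneg γ) ContinuousLinearMap.norm_id_le
              · rw [← hDeq (Yp t) (hin t ⟨ht.1, ht.2.trans ht'.2⟩)]; exact hKd _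
      have hcont : ContinuousOn uu (Icc 0 t') := fun t ht => (huu' t ht).continuousAt.continuousWithinAt
      have hut' : uu t' = 0 := by simp [huu, hzero]
      have hEq : EqOn uu (fun _ => (0 : EuclideanSpace ℝ (Fin 3))) (Icc 0 t') :=
        ODE_solution_unique_of_mem_Icc_left (v := fun t w => A t w) (s := fun _ => univ)
          (fun t ht => hKV t (Ioc_subset_Icc_self ht)) hcont
          (fun t ht => (huu' t (Ioc_subset_Icc_self ht)).hasDerivWithinAt) (fun _ _ => mem_univ _)
          continuousOn_const
          (fun t _ => by
            have h0 : HasDerivWithinAt (fun _ : ℝ => (0 : EuclideanSpace ℝ (Fin 3))) 0 (Iic t) t :=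
              hasDerivWithinAt_const _ _ _
            simpa using h0)
          (fun _ _ => mem_univ _) (by simpa using hut')
      have hu0 : uu 0 = 0 := hEq ⟨le_rfl, ht'.1⟩
      have : curl U x = 0 := by simpa [huu, hYp0] using hu0
      exact hcx this
    -- LAST time `s ≤ t₁` at which the orbit is inside `‖y‖ ≤ R₁`
    set S : Set ℝ := {t | 0 ≤ t ∧ t ≤ t₁ ∧ ‖Yp t‖ ≤ R₁} with hS
    have hSne : S.Nonempty := ⟨0, le_rfl, ht₁0, by rw [hYp0]; exact hxR.le⟩
    have hScl : IsClosed S := by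
      rw [hS, setOf_and, setOf_and]
      exact (isClosed_le continuous_const continuous_id).inter
        ((isClosed_le continuous_id continuous_const).inter (isClosed_le hYpc.norm continuous_const))
    have hSbdd : BddAbove S := ⟨t₁, fun t ht => ht.2.1⟩
    set s : ℝ := sSup S with hs
    have hsS : s ∈ S := hScl.csSup_mem hSne hSbdd
    have hs0 : 0 ≤ s := hsS.1
    have hst₁ : s ≤ t₁ := hsS.2.1
    have hsR₁ : ‖Yp s‖ ≤ R₁ := hsS.2.2
    have hslt : s < t₁ := by
      rcases hst₁.lt_or_eq with h | h
      · exact h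
      · exfalso; rw [h, hnorm₁] at hsR₁; linarith
    have hafter : ∀ t, s < t → t ≤ t₁ → R₁ < ‖Yp t‖ := by
      intro t hst htt
      by_contra hle
      push Not at hle
      have : t ≤ s := le_csSup hSbdd ⟨by linarith, htt, hle⟩
      linarith
    have hge : ∀ t ∈ Icc s t₁, R₁ ≤ ‖Yp t‖ := by
      intro t ht
      rcases ht.1.lt_or_eq with h | h
      · exact (hafter t h ht.2).le
      · rw [← h]
        by_contra hlt
        push Not at hlt
        have hev : ∀ᶠ r in 𝓝 s, ‖Yp r‖ < R₁ :=
          (hYpc.norm.continuousAt (x := s)).eventually (gt_mem_nhds hlt)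
        obtain ⟨δ, hδ, hball⟩ := Metric.eventually_nhds_iff.1 hev
        set r : ℝ := min (s + δ / 2) t₁ with hrdef
        have hsr : s < r := by rw [hrdef]; exact lt_min (by linarith) hslt
        have hrt : r ≤ t₁ := min_le_right _ _
        have hdist : dist r s < δ := by
          rw [Real.dist_eq, abs_of_nonneg (by linarith)]
          have : r ≤ s + δ / 2 := min_le_left _ _
          linarith
        have h1 := hball hdist
        have h2 := hafter r hsr hrt
        linarith
    -- `ℋ` along the orbit: `ℋ(Yp t) ≥ ℋ(x) ≥ h₀` on `[0, t₁]`
    have hHge : ∀ t ∈ Icc 0 t₁, h₀ ≤ Hb (Yp t) := by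
      intro t ht
      have hmono := selfSimilarBernoulli_monotone_backward hprof hγ2.le ht.1
        (fun r hr => hYpU' r ⟨hr.1, hr.2.trans ht.2⟩)
      have hx0 : h₀ ≤ Hb (Yp 0) := by rw [hYp0]; exact hfloor x hx
      exact hx0.trans hmono
    -- the orbit on `[s, t₁]`
    have hYst : ∀ t ∈ Icc s t₁, HasDerivAt Yp ((-1 : ℝ) • selfSimilarTransport γ 0 U (Yp t)) t :=
      fun t ht => hYpU' t ⟨hs0.trans ht.1, ht.2⟩
    have hlow : ∀ t ∈ Icc s t₁, m ≤ ‖selfSimilarTransport γ 0 U (Yp t)‖ ^ 2 :=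
      fun t ht => hspeed (Yp t) (hge t ht) (hHge t ⟨hs0.trans ht.1, ht.2⟩) (hvort t ⟨hs0.trans ht.1, ht.2⟩)
    -- kinetic budget: `∫ₛ^{t₁} ‖W‖² ≤ E`
    have hbudget : ∫ t in s..t₁, ‖selfSimilarTransport γ 0 U (Yp t)‖ ^ 2 ≤ E := by
      have hid := integral_norm_transport_sq_eq hprof hst₁ hYst
      have h1 : Hb (Yp t₁) ≤ Mb := hMb _ (hvort t₁ ⟨ht₁0, le_rfl⟩)
      have h2 : h₀ ≤ Hb (Yp s) := hHge s ⟨hs0, hst₁⟩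
      rw [hE, le_div_iff₀ h12, mul_comm]
      linarith
    -- displacement bound and the contradiction `K − R₁ ≤ E/√m`
    have hdisp := norm_sub_le_integral_div_sqrt hprof hst₁ hm0 hYst hlow
    have h1 : ‖Yp t₁‖ - ‖Yp s‖ ≤ ‖Yp t₁ - Yp s‖ := norm_sub_norm_le _ _
    have h2 : (∫ t in s..t₁, ‖selfSimilarTransport γ 0 U (Yp t)‖ ^ 2) / Real.sqrt m ≤ E / Real.sqrt m :=
      div_le_div_of_nonneg_right hbudget hsqm.le
    have h3 : K - R₁ ≤ E / Real.sqrt m := by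
      rw [hnorm₁] at h1
      linarith
    rw [hK] at h3
    linarith
  have hnull := volume_vortical_confined_eq_zero hprof hγ hγ2 hKpos
  have hopen : IsOpen {x : EuclideanSpace ℝ (Fin 3) | dist x x₀ < 1 ∧ curl U x ≠ 0} := by
    have h1 : IsOpen {x : EuclideanSpace ℝ (Fin 3) | dist x x₀ < 1} := isOpen_lt (continuous_id.dist continuous_const) continuous_const
    exact h1.inter (isOpen_ne_fun (differentiable_curl_of_contDiff hU2).continuous continuous_const)
  have hzero : volume {x : EuclideanSpace ℝ (Fin 3) | dist x x₀ < 1 ∧ curl U x ≠ 0} = 0 := measure_mono_null hsubset hnull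
  have hempty := (hopen.measure_eq_zero_iff volume).1 hzero
  by_contra hx₀
  have : x₀ ∈ ({x : EuclideanSpace ℝ (Fin 3) | dist x x₀ < 1 ∧ curl U x ≠ 0} : Set _) := ⟨by simp, hx₀⟩
  rw [hempty] at this
  exact this

/-! ### Member level (whole slab) -/

/-- **MEMBER LEVEL — an exactly self-similar in-class member whose `C²` velocity profile has, for every classical pressure `P′`, Bernoulli levels bounded above ON
THE VORTICAL SET and sub-critical pressure at the far VORTICAL points (`P′(y) ≤ ε‖y‖²`, `ε < ½γ(1−γ)`, `γ = 1/(2+ρ)`) is trivial.** [folklore] -/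
theorem selfSimilar_ae_eq_zero_of_vorticalBoundedBernoulliC2_profile {ρ : ℝ} (hρ : 0 < ρ) (hρ1 : ρ ≤ 1 / 2)
    {u : ℝ → EuclideanSpace ℝ (Fin 3) → EuclideanSpace ℝ (Fin 3)} {p : ℝ → EuclideanSpace ℝ (Fin 3) → ℝ}
    {H : ℝ → EuclideanSpace ℝ (Fin 3) → EuclideanSpace ℝ (Fin 3) →L[ℝ] EuclideanSpace ℝ (Fin 3)} {c : ℝ≥0}
    (hsw : IsSuitableWeakSolutionOn (slab (EuclideanSpace ℝ (Fin 3)) (Iio 0) isOpen_Iio) 0 0 u p)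
    (hgauge : ∀ a : ℝ, 0 < a →
      ENNReal.ofReal (a ^ (2 * ρ)) * cknA a (0 : ℝ × EuclideanSpace ℝ (Fin 3)) u +
          ENNReal.ofReal (a ^ ρ) * cknE a (0 : ℝ × EuclideanSpace ℝ (Fin 3)) H +
        ENNReal.ofReal (a ^ (2 * ρ)) * cknD a (0 : ℝ × EuclideanSpace ℝ (Fin 3)) p ≤ (c : ℝ≥0∞))
    {V : EuclideanSpace ℝ (Fin 3) → EuclideanSpace ℝ (Fin 3)} {P : EuclideanSpace ℝ (Fin 3) → ℝ}
    (hu : ∀ τ : ℝ, τ < 0 → u τ = selfSimilarCollapse (1 / (2 + ρ)) 0 V τ)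
    (hp : ∀ τ : ℝ, τ < 0 → p τ = selfSimilarCollapsePressure (1 / (2 + ρ)) 0 P τ)
    (hV : ContDiff ℝ 2 V)
    (hB : ∀ P' : EuclideanSpace ℝ (Fin 3) → ℝ, IsSelfSimilarEulerProfile (1 / (2 + ρ)) 0 V P' →
      (∃ Mb : ℝ, ∀ y, curl V y ≠ 0 → selfSimilarBernoulli (1 / (2 + ρ)) 0 V P' y ≤ Mb) ∧
      (∃ ε R₀ : ℝ, ε < (1 / (2 + ρ)) * (1 - 1 / (2 + ρ)) / 2 ∧
        ∀ y : EuclideanSpace ℝ (Fin 3), R₀ ≤ ‖y‖ → curl V y ≠ 0 → P' y ≤ ε * ‖y‖ ^ 2)) :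
    uncurry u =ᵐ[volume.restrict (Iio (0 : ℝ) ×ˢ (univ : Set (EuclideanSpace ℝ (Fin 3))))] 0 := by
  -- adapted from `selfSimilar_ae_eq_zero_of_boundedBernoulliC2_profile` (…SelfSimilarBernoulliBounded)
  have hρ1' : ρ < 1 := by linarith
  have h2ρ : (0 : ℝ) < 2 + ρ := by linarith
  have hγ : (0 : ℝ) < 1 / (2 + ρ) := one_div_pos.2 h2ρ
  have hγ2 : 1 / (2 + ρ) < 1 / 2 := one_div_lt_one_div_of_lt two_pos (by linarith)
  have hA : ∀ a : ℝ, 0 < a → ENNReal.ofReal (a ^ (2 * ρ)) *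
      cknA a (0 : ℝ × EuclideanSpace ℝ (Fin 3)) u ≤ (c : ℝ≥0∞) :=
    fun a ha => le_trans (le_trans le_self_add le_self_add) (hgauge a ha)
  have hD : ∀ a : ℝ, 0 < a → ENNReal.ofReal (a ^ (2 * ρ)) *
      cknD a (0 : ℝ × EuclideanSpace ℝ (Fin 3)) p ≤ (c : ℝ≥0∞) :=
    fun a ha => le_trans le_add_self (hgauge a ha)
  have hpm : AEStronglyMeasurable (uncurry p)
      (volume.restrict (Iio (0 : ℝ) ×ˢ (univ : Set (EuclideanSpace ℝ (Fin 3))))) := by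
    have := hsw.distributional.2.2.1.aestronglyMeasurable
    simpa [slab] using this
  have hPm := aestronglyMeasurable_pressureProfile hpm hp
  have hDprof := profile_pressure_weight_of_gaugeD hρ hρ1' hpm hp hD
  have hP1 : LocallyIntegrable P volume :=
    EnergySaturation.locallyIntegrable_pressure_of_weight hρ1' hPm
      (ENNReal.mul_ne_top ENNReal.ofReal_ne_top ENNReal.coe_ne_top) hDprof
  obtain ⟨P', hprof⟩ := WeakToClassical.exists_isSelfSimilarEulerProfile_of_contDiff hsw.distributional hu hp hV hP1
  obtain ⟨⟨Mb, hMb⟩, ⟨ε, R₀, hε, hPε⟩⟩ := hB P' hprof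
  have hcurl := curl_eq_zero_of_vortical_bernoulli_le hprof hγ hγ2 hMb hε hPε
  exact Loc.selfSimilar_ae_eq_zero_of_irrotationalC2_profile hρ hsw.distributional hA hu hV hcurl

end Summit.NavierStokesRegularity.NavierStokesRegularity.Theorems.PowerGaugeEulerLiouville.Loc
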